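import Summits.ValiantsHypothesis.ValiantsHypothesis.Theorems.SymPencilPerFourBoxInjective

/-!
# Route `SymPencil` — `per [𝟙; ·]` does not vanish on any product of three hyperplanes
# (tool file for the size-`27` cell `(12,4,2)` of `sdc(per_4)`, `--supports`
# stmt-ValiantsHypothesis-5674; rung currency only, nothing here bears on `VP ≠ VNP`)

**Theorem** (`exists_box_point`).  For any three linear forms `φ₀, φ₁, φ₂` on `K⁴` (zero allowed)
there are `y₀ ∈ ker φ₀`, `y₁ ∈ ker φ₁`, `y₂ ∈ ker φ₂` with `per [𝟙; y₀; y₁; y₂] ≠ 0`.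
Proof: `ker φ₂` contains `c` with `P(c)` injective (`SymPencilPerFourBoxInjective`); if
`T = per [𝟙; ·; ·; c]` vanished on `ker φ₀ × ker φ₁`, every `P(c) b` (`b ∈ ker φ₁`) would be a
multiple of the coefficient vector of `φ₀` (`exists_smul_of_dotProduct` there), and two vectors of
`ker φ₁` with disjoint pivots contradict injectivity.  This is the witness half of the hyperplane
flow rigidity of `per [𝟙; ·]` consumed by `SymPencilPerFourOneRowDefectTwoEndgame` /
`SymPencilSdcPerFourCellTwelveFour`: once a flow symmetry `X` is shown to vanish on a product of
hyperplanes inside `ker ℓ`, this file supplies the point with `X y = 0`, `per [𝟙; y] ≠ 0`.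
Characteristic `0`; no definitions, no named facts. [folklore]
-/

noncomputable section

-- single-conjunct layout: Sub = Summit, duplicated namespace component intended
set_option linter.dupNamespace false

namespace Summit.ValiantsHypothesis.ValiantsHypothesis.Theorems.SymPencilPerFourBoxNonvanishing

open Matrix
open Summit.ValiantsHypothesis.ValiantsHypothesis.Theorems.SymPencilPerFourInnerRankRows
open Summit.ValiantsHypothesis.ValiantsHypothesis.Theorems.SymPencilPerFourRowForms
open Summit.ValiantsHypothesis.ValiantsHypothesis.Theorems.SymPencilPerFourBoxInjective

variable {K : Type*} [Field K] [CharZero K]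

/-! ### The box theorem -/

/-- **`per [𝟙; ·]` does not vanish on any product of three hyperplanes.**  See the module
docstring. [folklore] -/
theorem exists_box_point (φ₀ φ₁ φ₂ : (Fin 4 → K) →ₗ[K] K) :
    ∃ y₀ y₁ y₂ : Fin 4 → K, φ₀ y₀ = 0 ∧ φ₁ y₁ = 0 ∧ φ₂ y₂ = 0 ∧
      (Matrix.of ![(fun _ => (1 : K)), y₀, y₁, y₂]).permanent ≠ 0 := by
  obtain ⟨c, hc, hinj⟩ := exists_injective_point φ₂
  by_contra H
  have H' : ∀ y₀ y₁ : Fin 4 → K, φ₀ y₀ = 0 → φ₁ y₁ = 0 →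
      (Matrix.of ![(fun _ => (1 : K)), y₀, y₁, c]).permanent = 0 := by
    intro y₀ y₁ h₀ h₁
    by_contra hne
    exact H ⟨y₀, y₁, c, h₀, h₁, hc, hne⟩
  -- coefficient vectors
  set f₀ : Fin 4 → K := fun k => φ₀ (Pi.single k 1) with hf₀
  set f₁ : Fin 4 → K := fun k => φ₁ (Pi.single k 1) with hf₁
  -- every `P(c) b`, `b ∈ ker φ₁`, is a multiple of `f₀`
  have hpar : ∀ b : Fin 4 → K, φ₁ b = 0 → ∃ α : K,
      (fun k => (Matrix.of ![(fun _ => (1 : K)), Pi.single k 1, b, c]).permanent) = α • f₀ := by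
    intro b hb
    refine exists_smul_of_dotProduct f₀ _ fun a ha => ?_
    rw [dotProduct_comm]
    have h := H' a b (by rw [apply_eq_dotProduct]; exact ha) hb
    rw [per_ones_eq_sum] at h
    simpa only [dotProduct] using h
  -- two vectors of `ker φ₁` spanning a plane
  obtain ⟨g, g', p, p', hg, hg', hgp, hgp', hg'p, hg'p', hne⟩ :
      ∃ (g g' : Fin 4 → K) (p p' : Fin 4), φ₁ g = 0 ∧ φ₁ g' = 0 ∧
        g p ≠ 0 ∧ g p' = 0 ∧ g' p = 0 ∧ g' p' ≠ 0 ∧ p ≠ p' := by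
    by_cases h1 : f₁ = 0
    · refine ⟨Pi.single 0 1, Pi.single 1 1, 0, 1, ?_, ?_, by simp, by simp, by simp, by simp,
        by decide⟩
      · rw [apply_eq_dotProduct]; change f₁ ⬝ᵥ _ = 0; rw [h1, zero_dotProduct]
      · rw [apply_eq_dotProduct]; change f₁ ⬝ᵥ _ = 0; rw [h1, zero_dotProduct]
    · obtain ⟨q, hq⟩ : ∃ q, f₁ q ≠ 0 := by
        by_contra hn
        push Not at hn
        exact h1 (funext hn)
      obtain ⟨p, p', hqp, hqp', hpp'⟩ := exists_pair_ne q
      refine ⟨f₁ q • Pi.single p 1 - f₁ p • Pi.single q 1,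
        f₁ q • Pi.single p' 1 - f₁ p' • Pi.single q 1, p, p', ?_, ?_, ?_, ?_, ?_, ?_, hpp'⟩
      · rw [apply_eq_dotProduct]; change f₁ ⬝ᵥ _ = 0
        rw [dotProduct_sub, dotProduct_smul, dotProduct_smul, dotProduct_single, dotProduct_single]
        simp only [smul_eq_mul, mul_one]; ring
      · rw [apply_eq_dotProduct]; change f₁ ⬝ᵥ _ = 0
        rw [dotProduct_sub, dotProduct_smul, dotProduct_smul, dotProduct_single, dotProduct_single]
        simp only [smul_eq_mul, mul_one]; ring
      · simp [hqp.symm, hq]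
      · simp [Ne.symm hpp', hqp'.symm]
      · simp [hpp', hqp.symm]
      · simp [hqp'.symm, hq]
  obtain ⟨α, hα⟩ := hpar g hg
  obtain ⟨β, hβ⟩ := hpar g' hg'
  -- `P(c) (β g - α g') = 0`, so `β g = α g'`, so `α = β = 0`, so `P(c) g = 0`, so `g = 0`
  have hcomb : β • g - α • g' = 0 := by
    refine hinj _ fun k => ?_
    rw [per_ones_single_sub_smul]
    have hk := congr_fun hα k
    have hk' := congr_fun hβ k
    simp only [Pi.smul_apply, smul_eq_mul] at hk hk'
    rw [hk, hk']
    ring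
  have hβ0 : β = 0 := by
    have h := congr_fun hcomb p
    simp only [Pi.sub_apply, Pi.smul_apply, smul_eq_mul, hg'p, mul_zero, sub_zero,
      Pi.zero_apply] at h
    exact (mul_eq_zero.1 h).resolve_right hgp
  have hα0 : α = 0 := by
    have h := congr_fun hcomb p'
    simp only [Pi.sub_apply, Pi.smul_apply, smul_eq_mul, hgp', mul_zero, zero_sub,
      Pi.zero_apply, neg_eq_zero] at h
    exact (mul_eq_zero.1 h).resolve_right hg'p'
  have hg0 : g = 0 := by
    refine hinj _ fun k => ?_
    have hk := congr_fun hα k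
    simp only [Pi.smul_apply, smul_eq_mul, hα0, zero_mul] at hk
    exact hk
  exact hgp (by rw [hg0]; rfl)

end Summit.ValiantsHypothesis.ValiantsHypothesis.Theorems.SymPencilPerFourBoxNonvanishing

end
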